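import Summits.Ventures.HSemireg.WedgeHankelSubstitutionSiegel
import Summits.Ventures.HSemireg.WedgeHankelPairMixingDet
import Summits.Ventures.HSemireg.WedgeHankelPairMixingSiegel
import Summits.Ventures.HSemireg.WedgeHankelNodeTorelli
import Summits.Ventures.HSemireg.WedgeHankelAnnihilatorTransport

/-!
# Venture HSemireg — THE TOP-COEFFICIENT PAIRING IS SEMI-INVARIANT UNDER THE MONOID: every substitution of the letters acts on the volume monomial by `(det g)^n`, every pair mixing by
# `(det M)²`, so `τ(Sb θ ∧ Sb η) = (det g)^n τ(θ ∧ η)` and `τ(Pm θ ∧ Pm η) = (det M)² τ(θ ∧ η)`, and for invertible elements EVERY ANNIHILATOR IS TRANSPORTED: `Ann(SbE W) = SbE(Ann W)`,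
# `Ann(PmE W) = PmE(Ann W)` — the uniform reason behind the transport of kernels, images, `SI_k` and the co-Siegel spaces (E1: `Kr = Ann V`, `SI_k = Ann coSiegel`)

HONEST FRAMING. Part of the Lean index of the computation cell `pub-hsemireg` (seat p10 gen 19, Sunday typer «UNIFORM-IN-n»).
Finite-dimensional EXTERIOR ALGEBRA over a field ONLY: no variety, no cohomology theory, no sheaf, no Ext group, no semiregularity map;
nothing here says that HC / HC_CM / HC_AV holds; no Literature fact is declared or used.  Custodian versions as in `WedgeHankelSiegelIdeal` (1/3); the dictionary (`τ` = the Serre-duality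
trace on `⋀^{2n}`; `Sb g` = `⋀(g ⊗ 1)`, determinant `(det g)^n`; `Pm M` = `⋀(1 ⊗ M ⊕ …)`, determinant `(det M)²`) is QUOTED, never asserted.

WHAT IS IN THE TREE.  E1 `WedgeKernelDuality`: `topCoeff` (`τ`), `Ann k W`, `mem_Ann`, the perfect pairing `finrank_Ann_add`, `Ann_Ann`, `Kr_w_eq_Ann` / `V_w_eq_Ann`; gen 16
`WedgeHankelAnnihilatorTransport`: `eq_topCoeff_smul_B_univ`, `topCoeff_mapEquiv` (`τ(mapEquiv g x) = τ(mapEquiv g E_univ)·τ(x)`, constant «never evaluated»), **`Ann_map_mapEquiv`**; H1b (909): `Sb_sv` (`Sb (s_{ab}) =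
det g · s_{ab}`), `SbE`, `Sb_mem_exteriorPower`; H9b (924): `Pm_w_eq_det_smul`, `PmE`; G7 `xmon_mul_spike_ne_zero` (`x_S ∧ E_k ≠ 0`); gen 11 `plane`, `pmon`, `w_spike_mem_plane`; I3:
`Pm_mem_exteriorPower`.  THIS FILE (namespace `Summit.Ventures.HSemireg.Wedge.KernelDuality` continued):
* §197 THE VOLUME MONOMIAL: `eq_topCoeff_smul_B_univ_nn` (gen 16's `eq_topCoeff_smul_B_univ` in degree `n + n`), `Sb_X_mul_Y` (`Sb (x_a y_a) = det g·(x_a y_a)`), `Sb_volProd` (`Sb (Π_{a<m} x_a y_a) =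
  (det g)^m·Π`), `volProd_eq_smul_B` (`Π_{a<m} x_a y_a = c·E_{Dm m}`, `c ≠ 0`), hence **`Sb_B_univ`: `Sb g (E_univ) = (det g)^n · E_univ` for EVERY `g`**, `Sb_of_mem_Hom_top`,
  **`topCoeff_Sb_mul`: `τ(Sb θ ∧ Sb η) = (det g)^n · τ(θ ∧ η)`** (`θ`, `η` homogeneous of complementary degrees).
* §198 the SCALING CONSTANT of gen 16's `topCoeff_mapEquiv` / `Ann_map_mapEquiv` (`WedgeHankelAnnihilatorTransport`: «the determinant of `g`; its value is never used») MADE EXPLICIT: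
  **`topCoeff_SbE_B_univ = (αδ − βγ)^n`**; `Ann_map_SbE` (the instance `g = sbEquiv h` of `Ann_map_mapEquiv`, recorded for the atlas).
* §199 PAIR MIXINGS: `plane_top_zero_eq_span` (`plane(n, 0) = K ∙ x_univ`), `w_spike_zero_mul_w_spike_top_ne_zero` (`E_0 ∧ E_n ≠ 0`, G7), **`Pm_B_univ`: `Pm M (E_univ) = (det M)² · E_univ`
  for EVERY `M`** (H9b on `E_0` and `E_n`), `Pm_of_mem_Hom_top`, **`topCoeff_Pm_mul`**, `topCoeff_PmE_B_univ` (`= (det M)²`), `Ann_map_PmE` (instance of `Ann_map_mapEquiv`).  NEW versus gen 16: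
  the semi-invariance for ALL elements of the monoid (singular `g`, `M` included) with the explicit weights `(det g)^n`, `(det M)²`.
NOT typed here: `det(sbLin g) = (det g)^n` / `det(pmLin M) = (det M)²` as `LinearMap.det` statements on the letters (we act on `⋀^{2n}` directly); singular elements (they kill `⋀^{2n}` when the
respective determinant vanishes — immediate from §197/§199); anything Ext-side.  New names only.
-/

open Module

namespace Summit.Ventures.HSemireg.Wedge.KernelDuality

open Summit.Ventures.HSemireg.Wedge Summit.Ventures.HSemireg.Wedge.Kunneth Summit.Ventures.HSemireg.Wedge.Hankel
  Summit.Ventures.HSemireg.Wedge.KunnethKernel Summit.Ventures.HSemireg.Wedge.HankelSiegel Summit.Ventures.HSemireg.Wedge.HankelSiegelIdeal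
  Summit.Ventures.HSemireg.Wedge.HankelFrameChange Summit.Ventures.HSemireg.Wedge.HankelPairMixing Summit.Ventures.HSemireg.Wedge.BasisFree
  Summit.Ventures.HSemireg.Wedge.Weil

variable (K : Type*) [Field K] {n : ℕ}

/-! ## §197. The volume monomial under a substitution of the letters -/

/-- a top-degree form is its top coefficient times the volume monomial — gen 16's `eq_topCoeff_smul_B_univ` (`WedgeHankelAnnihilatorTransport`) with the degree written `n + n`. -/
lemma eq_topCoeff_smul_B_univ_nn {θ : HT K (In n)} (hθ : θ ∈ Hom K (In n) Finset.univ (n + n)) : θ = topCoeff K θ • B K (In n) Finset.univ :=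
  eq_topCoeff_smul_B_univ K (by rwa [Fintype.card_fin])

/-- `τ(E_univ) = 1`. -/
lemma topCoeff_B_univ : topCoeff K (B K (In n) Finset.univ) = 1 := by
  rw [topCoeff_apply, Basis.coord_apply, Basis.repr_self, Finsupp.single_eq_same]

/-- **`Sb (x_a ∧ y_a) = (αδ − βγ) · (x_a ∧ y_a)`** (H1b `Sb_sv` on the diagonal Siegel vector `s_{aa} = x_a y_a`). -/
theorem Sb_X_mul_Y (α β γ δ : K) (a : ℕ) : Sb K α β γ δ (X K n a * Y K n a) = (α * δ - β * γ) • (X K n a * Y K n a) := by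
  have h := Sb_sv K α β γ δ a a (n := n)
  rwa [sv, if_pos rfl, add_zero] at h

/-- **`Sb (Π_{a<m} x_a y_a) = (αδ − βγ)^m · Π_{a<m} x_a y_a`** (the ordered product of the first `m` pair products). -/
theorem Sb_volProd (α β γ δ : K) : ∀ m : ℕ,
    Sb K α β γ δ (((List.range m).map fun a => X K n a * Y K n a).prod) = (α * δ - β * γ) ^ m • ((List.range m).map fun a => X K n a * Y K n a).prod
  | 0 => by rw [List.range_zero, List.map_nil, List.prod_nil, map_one, pow_zero, one_smul]
  | m + 1 => by
    rw [List.range_succ, List.map_append, List.prod_append, List.map_singleton, List.prod_singleton, map_mul, Sb_volProd α β γ δ m, Sb_X_mul_Y, smul_mul_smul_comm, pow_succ]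

/-- **`Π_{a<m} x_a y_a = c · E_{Dm m}` with `c ≠ 0`** (`m ≤ n`; the supports `{x_a, y_a}` are disjoint, the structure constants are units). -/
theorem volProd_eq_smul_B : ∀ {m : ℕ}, m ≤ n → ∃ c : K, c ≠ 0 ∧ ((List.range m).map fun a => X K n a * Y K n a).prod = c • B K (In n) (Dm n m)
  | 0, _ => ⟨1, one_ne_zero, by rw [List.range_zero, List.map_nil, List.prod_nil, Dm_zero, B_empty, one_smul]⟩
  | m + 1, hm => by
    have hmn : m < n := by omega
    obtain ⟨c, hc, e⟩ := volProd_eq_smul_B (show m ≤ n by omega)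
    have hxy : X K n m * Y K n m = u K ({xI m hmn} : Finset (In n)) {yI m hmn} • B K (In n) {xI m hmn, yI m hmn} := by
      rw [X, Y, dif_pos hmn, dif_pos hmn, gx_mul_gy]
    have hd1 : Disjoint ({xI m hmn} : Finset (In n)) {yI m hmn} := Finset.disjoint_singleton.mpr (xI_ne_yI hmn)
    have hd2 : Disjoint (Dm n m) ({xI m hmn, yI m hmn} : Finset (In n)) := by
      rw [Finset.disjoint_insert_right, Finset.disjoint_singleton_right]; exact ⟨xI_notMem hmn, yI_notMem hmn⟩
    have hD : Dm n m ∪ ({xI m hmn, yI m hmn} : Finset (In n)) = Dm n (m + 1) := by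
      rw [Dm_succ hmn]; ext i; simp only [Finset.mem_union, Finset.mem_insert, Finset.mem_singleton]; tauto
    refine ⟨c * u K ({xI m hmn} : Finset (In n)) {yI m hmn} * u K (Dm n m) {xI m hmn, yI m hmn},
      mul_ne_zero (mul_ne_zero hc ((u_ne_zero_iff K).mpr hd1)) ((u_ne_zero_iff K).mpr hd2), ?_⟩
    rw [List.range_succ, List.map_append, List.prod_append, List.map_singleton, List.prod_singleton, e, hxy, smul_mul_smul_comm, B_mul_B, smul_smul, hD]

/-- **`Sb g (E_univ) = (αδ − βγ)^n · E_univ` for EVERY substitution `g`** (the volume monomial is a `det^n`-eigenvector; dictionary: `det ⋀^{2n}(g ⊗ 1_n) = (det g)^n`). -/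
theorem Sb_B_univ (α β γ δ : K) : Sb K α β γ δ (B K (In n) Finset.univ) = (α * δ - β * γ) ^ n • B K (In n) Finset.univ := by
  obtain ⟨c, hc, e⟩ := volProd_eq_smul_B K (n := n) le_rfl
  rw [Dm_top] at e
  have h := Sb_volProd K α β γ δ n (n := n)
  rw [e, map_smul, smul_smul, mul_comm, ← smul_smul] at h
  exact smul_right_injective _ hc h

/-- **every substitution acts on the top degree by `(det g)^n`: `Sb g θ = (αδ − βγ)^n · θ` for `θ ∈ Hom(univ, 2n)`.** -/
theorem Sb_of_mem_Hom_top (α β γ δ : K) {θ : HT K (In n)} (hθ : θ ∈ Hom K (In n) Finset.univ (n + n)) : Sb K α β γ δ θ = (α * δ - β * γ) ^ n • θ := by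
  conv_lhs => rw [eq_topCoeff_smul_B_univ_nn K hθ, map_smul, Sb_B_univ, smul_comm]
  rw [← eq_topCoeff_smul_B_univ_nn K hθ]

/-- **THE PAIRING IS SEMI-INVARIANT: `τ(Sb θ ∧ Sb η) = (αδ − βγ)^n · τ(θ ∧ η)`** for `θ ∈ Hom(univ, a)`, `η ∈ Hom(univ, b)`, `a + b = 2n`, EVERY substitution. -/
theorem topCoeff_Sb_mul (α β γ δ : K) {a b : ℕ} (hab : a + b = n + n) {θ η : HT K (In n)} (hθ : θ ∈ Hom K (In n) Finset.univ a) (hη : η ∈ Hom K (In n) Finset.univ b) :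
    topCoeff K (Sb K α β γ δ θ * Sb K α β γ δ η) = (α * δ - β * γ) ^ n * topCoeff K (θ * η) := by
  have hm : θ * η ∈ Hom K (In n) Finset.univ (n + n) := by
    rw [Hom_univ_eq_exteriorPower] at hθ hη ⊢
    rw [← hab]
    exact SetLike.mul_mem_graded hθ hη
  rw [← map_mul, Sb_of_mem_Hom_top K α β γ δ hm, map_smul, smul_eq_mul]

/-! ## §198. The scaling constant of gen 16's annihilator transport, made explicit -/

/-- **the constant of gen 16's `topCoeff_mapEquiv` for an invertible substitution is `(det g)^n`: `τ(SbE h (E_univ)) = (αδ − βγ)^n`** (so `Ann_map_mapEquiv` applies to `SbE h = mapEquiv (sbEquiv h)`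
with an explicit, non-zero constant). -/
theorem topCoeff_SbE_B_univ {α β γ δ : K} (h : α * δ - β * γ ≠ 0) : topCoeff K (SbE K (n := n) h (B K (In n) Finset.univ)) = (α * δ - β * γ) ^ n := by
  rw [SbE_apply, Sb_B_univ, map_smul, topCoeff_B_univ, smul_eq_mul, mul_one]

/-- annihilators under an invertible substitution: `Ann_j(SbE W) = SbE(Ann_j W)` — the instance `g = sbEquiv h` of gen 16's `Ann_map_mapEquiv` (recorded for the atlas; no new content). -/
theorem Ann_map_SbE {α β γ δ : K} (h : α * δ - β * γ ≠ 0) (j : ℕ) (W : Submodule K (HT K (In n))) :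
    Ann K j (W.map (SbE K (n := n) h).toLinearMap) = (Ann K j W).map (SbE K (n := n) h).toLinearMap :=
  Ann_map_mapEquiv K (sbEquiv K (n := n) h) j W

/-! ## §199. The volume monomial under a pair mixing; annihilators under `PmE` -/

/-- the pure `x`-plane of top `x`-count is the line of `x_univ`: `plane(n, 0) = K ∙ x_univ`. -/
theorem plane_top_zero_eq_span :
    plane K n n 0 = K ∙ pmon K ((⟨Finset.univ, Finset.card_fin n⟩, ⟨∅, Finset.card_empty⟩) : PIdx n n 0) := by
  rw [plane]
  congr 1
  ext x
  simp only [Set.mem_range, Set.mem_singleton_iff]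
  constructor
  · rintro ⟨⟨⟨P, hP⟩, ⟨Q, hQ⟩⟩, rfl⟩
    have hP' : P = Finset.univ := Finset.eq_univ_of_card P (by rw [hP, Fintype.card_fin])
    have hQ' : Q = ∅ := Finset.card_eq_zero.mp hQ
    subst hP' hQ'
    rfl
  · rintro rfl; exact ⟨_, rfl⟩

/-- **`E_0 ∧ E_n ≠ 0`** (`E_0 = w_n(δ_0)` spans `plane(n,0)`, and `x_univ ∧ E_n ≠ 0` by G7). -/
theorem w_spike_zero_mul_w_spike_top_ne_zero :
    w K n n (fun j => if j = 0 then (1 : K) else 0) * w K n n (fun j => if j = n then (1 : K) else 0) ≠ 0 := by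
  have h0 : w K n n (fun j => if j = 0 then (1 : K) else 0) ∈ plane K n n 0 := by
    have := w_spike_mem_plane K (n := n) le_rfl (Nat.zero_le n); rwa [Nat.sub_zero] at this
  rw [plane_top_zero_eq_span, Submodule.mem_span_singleton] at h0
  obtain ⟨t, ht⟩ := h0
  have ht0 : t ≠ 0 := by
    rintro rfl; rw [zero_smul] at ht; exact w_spike_ne_zero K (Nat.zero_le n) ht.symm
  rw [← ht, smul_mul_assoc, smul_ne_zero_iff]
  exact ⟨ht0, xmon_mul_spike_ne_zero K _⟩

/-- `E_0 ∧ E_n` is a top-degree form. -/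
lemma w_spike_zero_mul_w_spike_top_mem_Hom :
    w K n n (fun j => if j = 0 then (1 : K) else 0) * w K n n (fun j => if j = n then (1 : K) else 0) ∈ Hom K (In n) Finset.univ (n + n) := by
  have h0 : w K n n (fun j => if j = 0 then (1 : K) else 0) ∈ ⋀[K]^n (In n → K) := by rw [← Hom_univ_eq_exteriorPower]; exact w_top_mem_Hom K _
  have hn : w K n n (fun j => if j = n then (1 : K) else 0) ∈ ⋀[K]^n (In n → K) := by rw [← Hom_univ_eq_exteriorPower]; exact w_top_mem_Hom K _
  rw [Hom_univ_eq_exteriorPower]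
  exact SetLike.mul_mem_graded h0 hn

/-- **`Pm M (E_univ) = (det M)² · E_univ` for EVERY pair mixing `M`** (H9b: `Pm M` scales both `E_0` and `E_n` by `det M`). -/
theorem Pm_B_univ (M : Matrix (Fin n) (Fin n) K) : Pm K M (B K (In n) Finset.univ) = M.det ^ 2 • B K (In n) Finset.univ := by
  have hP : Pm K M (w K n n (fun j => if j = 0 then (1 : K) else 0) * w K n n (fun j => if j = n then (1 : K) else 0)) =
      M.det ^ 2 • (w K n n (fun j => if j = 0 then (1 : K) else 0) * w K n n (fun j => if j = n then (1 : K) else 0)) := by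
    rw [map_mul, Pm_w_eq_det_smul, Pm_w_eq_det_smul, smul_mul_smul_comm, sq]
  have e := eq_topCoeff_smul_B_univ_nn K (w_spike_zero_mul_w_spike_top_mem_Hom K (n := n))
  have ht : topCoeff K (w K n n (fun j => if j = 0 then (1 : K) else 0) * w K n n (fun j => if j = n then (1 : K) else 0)) ≠ 0 := by
    intro h0; rw [h0, zero_smul] at e; exact w_spike_zero_mul_w_spike_top_ne_zero K e
  rw [e, map_smul, smul_comm] at hP
  exact smul_right_injective _ ht hP

/-- **every pair mixing acts on the top degree by `(det M)²`.** -/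
theorem Pm_of_mem_Hom_top (M : Matrix (Fin n) (Fin n) K) {θ : HT K (In n)} (hθ : θ ∈ Hom K (In n) Finset.univ (n + n)) : Pm K M θ = M.det ^ 2 • θ := by
  conv_lhs => rw [eq_topCoeff_smul_B_univ_nn K hθ, map_smul, Pm_B_univ, smul_comm]
  rw [← eq_topCoeff_smul_B_univ_nn K hθ]

/-- **`τ(Pm θ ∧ Pm η) = (det M)² · τ(θ ∧ η)`** for homogeneous `θ`, `η` of complementary degrees, EVERY `M`. -/
theorem topCoeff_Pm_mul (M : Matrix (Fin n) (Fin n) K) {a b : ℕ} (hab : a + b = n + n) {θ η : HT K (In n)} (hθ : θ ∈ Hom K (In n) Finset.univ a) (hη : η ∈ Hom K (In n) Finset.univ b) :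
    topCoeff K (Pm K M θ * Pm K M η) = M.det ^ 2 * topCoeff K (θ * η) := by
  have hm : θ * η ∈ Hom K (In n) Finset.univ (n + n) := by
    rw [Hom_univ_eq_exteriorPower] at hθ hη ⊢
    rw [← hab]
    exact SetLike.mul_mem_graded hθ hη
  rw [← map_mul, Pm_of_mem_Hom_top K M hm, map_smul, smul_eq_mul]

/-- **the constant for an invertible pair mixing is `(det M)²`: `τ(PmE hM (E_univ)) = (det M)²`.** -/
theorem topCoeff_PmE_B_univ {M : Matrix (Fin n) (Fin n) K} (hM : M.det ≠ 0) : topCoeff K (PmE K (n := n) hM (B K (In n) Finset.univ)) = M.det ^ 2 := by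
  rw [PmE_apply, Pm_B_univ, map_smul, topCoeff_B_univ, smul_eq_mul, mul_one]

/-- annihilators under an invertible pair mixing: `Ann_j(PmE W) = PmE(Ann_j W)` — the instance `g = pmEquiv hM` of gen 16's `Ann_map_mapEquiv` (recorded for the atlas; no new content). -/
theorem Ann_map_PmE {M : Matrix (Fin n) (Fin n) K} (hM : M.det ≠ 0) (j : ℕ) (W : Submodule K (HT K (In n))) :
    Ann K j (W.map (PmE K (n := n) hM).toLinearMap) = (Ann K j W).map (PmE K (n := n) hM).toLinearMap :=
  Ann_map_mapEquiv K (pmEquiv K hM) j W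

end Summit.Ventures.HSemireg.Wedge.KernelDuality
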